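import Literature.NumberTheory.Transcendental.KZGroundingRelations
import Summits.KontsevichZagierPeriods.KontsevichZagierPeriods.Theorems.HurwitzMicroSectorsNormalFormPrincipleDimOneAssembly

/-!
# Item stmt-KontsevichZagierPeriods-0541, line `SketchIdeator2`: the planar volume form for bodies with
# rational vertical sections (rung `d = 1`, rational sub-case, unconditional with exponent `0`)

Support file (`--supports` stmt-KontsevichZagierPeriods-0541, registered stub
`equivalent_of_rational_sections`).  The dimension ladder places the first open rung of the crux at `d = 1`:
the planar volume form is Conjecture 1 / Conjecture 7 for formal `ℤ`-combinations of one-dimensional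
representations (real 1-periods).  Its RATIONAL-integrand part is a theorem of the tree (Baker;
`Dlog.mem_relations_of_eval_eq_zero_of_dim_le_one`, p124986).  Read back in the plane this gives the first
unconditional planar instances of the volume form beyond scissors congruence:

**Theorem (`equivalent_of_rational_sections`).**  Let `K₁, K₂ ⊂ ℝ²` be bodies with rational vertical sections,
`Kᵢ = {(x, t) | x ∈ τᵢ, gᵢ x ≤ t ≤ hᵢ x}` with `τᵢ ⊆ ℝ` `ℚ`-semialgebraic and `gᵢ < hᵢ` on `τᵢ` given by
quotients of `ℚ`-polynomials (regular on `τᵢ`), taken with integrand `1` (so of finite area; compactness is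
not required).  If `area K₁ = area K₂` then `K₁` and `K₂` are KZ-equivalent.  Proof: one Newton–Leibniz move
down each band (`KZ.exists_band_sub_base_mem_newtonLeibnizRel`, primitive `t`) lands on the one-dimensional
rational representation `∫_{τᵢ} (hᵢ − gᵢ)`, and the difference of the two has value `0`, hence is a relation by
Conjecture 1 in dimension `≤ 1` (Baker).  Areas covered: `ℚ̄ ∩ (ℚ̄ + Σ ℚ̄ log ℚ̄ + ℚ̄ π)`, e.g. the regions under
`1/x` over `[1, 2]` (`log 2`), under `1/(1 + x²)` over `ℝ` (`π`), under a parabola over an algebraic interval.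

References: M. Kontsevich, D. Zagier, *Periods* (2001), §1.2; A. Baker, *Transcendental Number Theory*
(1975), Thm. 2.1; J. Cresson, J. Viu-Sos, JTNB 34 (2022), §1.  No definition is introduced.
-/

noncomputable section

open MeasureTheory Set MvPolynomial
open Literature.ModelTheory.ExponentialFields
open Literature.NumberTheory.Transcendental Literature.NumberTheory.Transcendental.KZ

namespace Summit.KontsevichZagierPeriods.LiouvilleUnfolding.NilradicalCut

open Summit.KontsevichZagierPeriods.HurwitzMicroSectors.NormalFormPrinciple.PiBox.Dlog
  (mem_relations_of_eval_eq_zero_of_dim_le_one)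

/-- **Down the band onto a rational base.**  A planar integrand-`1` representation whose domain is the band
`{(x, t) | x ∈ τ, g x ≤ t ≤ h x}` over a `ℚ`-semialgebraic `τ ⊆ ℝ`, with `g < h` on `τ` quotients of
`ℚ`-polynomials regular on `τ`, differs by relations from a one-dimensional representation of KZ's rational
shape (namely `∫_τ (h − g)`): close the open band by null graphs and apply Newton–Leibniz with primitive `t`
(`KZ.exists_band_sub_base_mem_newtonLeibnizRel`). [cite: KontsevichZagier2001, §1.2 rule (3)] -/
theorem exists_isRational_sub_mem_relations_of_rational_sections {τ : Set (Fin 1 → ℝ)}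
    (hτ : IsSemialgebraic ℚ τ) {g h : (Fin 1 → ℝ) → ℝ}
    (hg : ∃ p q : MvPolynomial (Fin 1) ℚ, (∀ x ∈ τ, aeval x q ≠ 0) ∧ ∀ x ∈ τ, g x = aeval x p / aeval x q)
    (hh : ∃ p q : MvPolynomial (Fin 1) ℚ, (∀ x ∈ τ, aeval x q ≠ 0) ∧ ∀ x ∈ τ, h x = aeval x p / aeval x q)
    (hlt : ∀ x ∈ τ, g x < h x) (K : IntegralRep 2) (hKd : K.domain = KZlog.band τ g h)
    (hK1 : ∀ z ∈ K.domain, K.integrand z = 1) :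
    ∃ b : IntegralRep 1, b.IsRational ∧ of K - of b ∈ relations := by
  obtain ⟨pg, qg, hqg, hgq⟩ := hg
  obtain ⟨ph, qh, hqh, hhq⟩ := hh
  have hgsa : IsSemialgebraicFunOn ℚ τ g :=
    (isSemialgebraicFunOn_aeval_div_aeval hτ pg qg hqg).congr fun x hx => (hgq x hx).symm
  have hhsa : IsSemialgebraicFunOn ℚ τ h :=
    (isSemialgebraicFunOn_aeval_div_aeval hτ ph qh hqh).congr fun x hx => (hhq x hx).symm
  -- the two sections as a cylindrical datum `ξ = (g, h)` over `τ`; the body is the closure of the inner band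
  set ξ : Fin 2 → (Fin 1 → ℝ) → ℝ := ![g, h] with hξ_def
  have hξ0 : ξ 0 = g := rfl
  have hξ1 : ξ 1 = h := rfl
  have hξ : ∀ i, IsSemialgebraicFunOn ℚ τ (ξ i) := by
    intro i; fin_cases i
    · exact hgsa
    · exact hhsa
  have hmono : ∀ x ∈ τ, StrictMono fun i => ξ i x := by
    intro x hx
    refine Fin.strictMono_iff_lt_succ.mpr fun i => ?_
    fin_cases i
    exact hlt x hx
  have h10 : (1 : Fin 3) ≠ 0 := by decide
  have h1l : (1 : Fin 3) ≠ Fin.last 2 := by decide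
  have hlo : ∀ x, (bandLower ξ 1 x).toReal = g x := fun x => by
    rw [bandLower_of_ne_zero ξ 1 h10, EReal.toReal_coe]; rfl
  have hup : ∀ x, (bandUpper ξ 1 x).toReal = h x := fun x => by
    rw [bandUpper_of_ne_last ξ 1 h1l, EReal.toReal_coe]; rfl
  -- the open band sits inside the body, which has finite area
  have hsub : bandOver τ ξ 1 ⊆ K.domain := by
    intro z hz
    rw [mem_bandOver_iff, bandLower_of_ne_zero ξ 1 h10, bandUpper_of_ne_last ξ 1 h1l,
      EReal.coe_lt_coe_iff, EReal.coe_lt_coe_iff] at hz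
    rw [hKd, KZlog.mem_band]
    exact ⟨hz.1, le_of_lt hz.2.1, le_of_lt hz.2.2⟩
  have hfin : volume K.domain ≠ ⊤ := volume_ne_top_of_integrand_one K hK1
  obtain ⟨Bd, b, hBdd, hBdi, hbd, hbi, hNL⟩ :=
    exists_band_sub_base_mem_newtonLeibnizRel hfin hτ ξ hξ hmono h10 h1l hsub
  -- `Bd` is the body itself (same domain, integrand `1` on it)
  have hBdK : Bd.domain = K.domain := by
    rw [hBdd, hKd]
    ext z
    simp only [KZlog.mem_band, hlo, hup]
  have e1 : of K - of Bd ∈ relations :=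
    of_sub_of_mem_relations_of_eqOn hBdK fun z hz => by rw [hK1 z hz, hBdi]
  refine ⟨b, ?_, ?_⟩
  · -- `b = ∫_τ (h − g)` has KZ's rational shape: `h − g = (p_h q_g − p_g q_h) / (q_h q_g)` on `τ`
    refine ⟨ph * qg - pg * qh, qh * qg, fun x hx => ?_, fun x hx => ?_⟩
    · have hx' : x ∈ τ := by rwa [hbd] at hx
      rw [map_mul]
      exact mul_ne_zero (hqh x hx') (hqg x hx')
    · have hx' : x ∈ τ := by rwa [hbd] at hx
      rw [hbi]
      simp only [hup, hlo, map_sub, map_mul]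
      rw [hhq x hx', hgq x hx']
      field_simp [hqh x hx', hqg x hx']
  · have : of K - of b = (of K - of Bd) + (of Bd - of b) := by abel
    rw [this]
    exact relations.add_mem e1 (newtonLeibnizRel_subset_relations hNL)

/-- **Registered stub `equivalent_of_rational_sections` — the planar volume form for bodies with rational
vertical sections, unconditionally.**  Two planar bodies `Kᵢ = {(x, t) | x ∈ τᵢ, gᵢ x ≤ t ≤ hᵢ x}`
(`τᵢ ⊆ ℝ` `ℚ`-semialgebraic, `gᵢ < hᵢ` quotients of `ℚ`-polynomials regular on `τᵢ`, integrand `1`, finite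
area; no compactness) of EQUAL AREA are KZ-equivalent: each is one Newton–Leibniz move above the rational
one-dimensional representation `∫_{τᵢ} (hᵢ − gᵢ)` (`exists_isRational_sub_mem_relations_of_rational_sections`),
and Conjecture 1 holds for combinations of rational representations of dimension `≤ 1` (Baker,
`Dlog.mem_relations_of_eval_eq_zero_of_dim_le_one`).  The first unconditional planar instances of the
volume form of item 0541 (exponent `N = 0`) with transcendental areas (`log 2`, `π`, …).
[cite: KontsevichZagier2001, §1.2 Conjecture 1] -/
theorem equivalent_of_rational_sections : ∀ (τ₁ τ₂ : Set (Fin 1 → ℝ)) (g₁ h₁ g₂ h₂ : (Fin 1 → ℝ) → ℝ), Literature.ModelTheory.ExponentialFields.IsSemialgebraic ℚ τ₁ → Literature.ModelTheory.ExponentialFields.IsSemialgebraic ℚ τ₂ → (∃ p q : MvPolynomial (Fin 1) ℚ, (∀ x ∈ τ₁, MvPolynomial.aeval x q ≠ 0) ∧ ∀ x ∈ τ₁, g₁ x = MvPolynomial.aeval x p / MvPolynomial.aeval x q) → (∃ p q : MvPolynomial (Fin 1) ℚ, (∀ x ∈ τ₁, MvPolynomial.aeval x q ≠ 0) ∧ ∀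 x ∈ τ₁, h₁ x = MvPolynomial.aeval x p / MvPolynomial.aeval x q) → (∃ p q : MvPolynomial (Fin 1) ℚ, (∀ x ∈ τ₂, MvPolynomial.aeval x q ≠ 0) ∧ ∀ x ∈ τ₂, g₂ x = MvPolynomial.aeval x p / MvPolynomial.aeval x q) → (∃ p q : MvPolynomial (Fin 1) ℚ, (∀ x ∈ τ₂, MvPolynomial.aeval x q ≠ 0) ∧ ∀ x ∈ τ₂, h₂ x = MvPolynomial.aeval x p / MvPolynomial.aeval x q) → (∀ x ∈ τ₁, g₁ x < h₁ x) → (∀ x ∈ τ₂, g₂ x < h₂ x) → ∀ (K₁ K₂ : KZ.IntegralRep 2), K₁.domain = KZlog.band τ₁ g₁ h₁ → K₂.domain = KZlog.band τ₂ g₂ h₂ → (∀ z ∈ K₁.domain, K₁.integrand z = 1) → (∀ z ∈ K₂.domain, K₂.integrand z = 1) → K₁.value = K₂.value → KZ.Equivalent K₁ K₂ := by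
  intro τ₁ τ₂ g₁ h₁ g₂ h₂ hτ₁ hτ₂ hg₁ hh₁ hg₂ hh₂ hlt₁ hlt₂ K₁ K₂ hd₁ hd₂ hi₁ hi₂ hv
  obtain ⟨b₁, hb₁, e₁⟩ := exists_isRational_sub_mem_relations_of_rational_sections hτ₁ hg₁ hh₁ hlt₁ K₁ hd₁ hi₁
  obtain ⟨b₂, hb₂, e₂⟩ := exists_isRational_sub_mem_relations_of_rational_sections hτ₂ hg₂ hh₂ hlt₂ K₂ hd₂ hi₂
  have hval : eval (of b₁ - of b₂) = 0 := by
    have f₁ := relations_le_ker_eval_holds e₁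
    have f₂ := relations_le_ker_eval_holds e₂
    rw [AddMonoidHom.mem_ker, map_sub, eval_of, eval_of] at f₁ f₂
    rw [map_sub, eval_of, eval_of]
    change K₁.value = K₂.value at hv
    linarith
  have hb : of b₁ - of b₂ ∈ relations :=
    mem_relations_of_eval_eq_zero_of_dim_le_one (sub_mem (AddSubgroup.subset_closure ⟨1, b₁, le_rfl, hb₁, rfl⟩)
      (AddSubgroup.subset_closure ⟨1, b₂, le_rfl, hb₂, rfl⟩)) hval
  have : of K₁ - of K₂ = (of K₁ - of b₁) + (of b₁ - of b₂) - (of K₂ - of b₂) := by abel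
  rw [Equivalent, this]
  exact relations.sub_mem (relations.add_mem e₁ hb) e₂

end Summit.KontsevichZagierPeriods.LiouvilleUnfolding.NilradicalCut

end
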